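import Summits.QuantumFields.YangMills.Theses.LangevinControlUV
import Literature.MathematicalPhysics.QuantumFieldTheory.MassGapFromDiagonalClustering

/-!
# Crux `GapToContinuum` (stmt-QuantumFields-8896) — RESTATEMENT R5 (diagonal interface), lead a1

Evidence file (elaborates; no `sorry`).  With L1 landed
(`Literature/MathematicalPhysics/QuantumFieldTheory/MassGapFromDiagonalClustering.lean`:
`IsYangMillsFor.hasMassGap_of_diagClustering`), the recommended re-type of the crux makes it a THEOREM:

* `HasDiagClusteringInline r sch Δ` — the diagonal lattice clustering clause (one slab-ordered real
  factor datum at a time, FREE constant, eventually in `k`, slack `ε`), written def-free (it is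
  verbatim `SpeciesScheme.HasDiagClustering r sch Δ` of the review-queued
  `DiagonalLatticeClustering.lean`; use that name once it lands);
* `GapToContinuumDiag` (R5) := `∀ G r sch T Δ, 0 < Δ → IsYangMillsFor r sch T →
  HasDiagClusteringInline r sch Δ → T.HasMassGap Δ` — PROVED (`gapToContinuumDiag_holds`);
* `OSLegsAtWeakCouplingDiag` := stmt-QuantumFields-16207 (`OSLegsAtWeakCouplingC`) VERBATIM with the
  last conjunct `∃ Δ > 0, HasLatticeMassGap r sch Δ` strengthened to
  `∃ Δ > 0, HasLatticeMassGap r sch Δ ∧ HasDiagClusteringInline r sch Δ` (the scheme is existential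
  there: whoever builds `sch` chooses `L_k`, `c_s`, `β_k` and can deliver one diagonal bound per tensor
  with any constant);
* `closes_restatedDiag : FemtoCurvatureTwoPointC → FemtoCurvatureSkewnessC → LatticeGapInUVUnitsC →
  OSLegsAtWeakCouplingDiag → YangMills` — the deciding theorem re-elaborates with FOUR hypotheses (the
  gap-transfer crux is discharged by `gapToContinuumDiag_holds`).

So: re-type 8896 to `GapToContinuumDiag` (closed at once by this seat) and 16207 to
`OSLegsAtWeakCouplingDiag`; or drop 8896 from `closes` altogether.
-/

noncomputable section

open scoped SchwartzMap
open MeasureTheory Filter Topology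
open Literature.MathematicalPhysics.AQFT Literature.MathematicalPhysics.QuantumLattice
open Literature.MathematicalPhysics.QuantumFieldTheory Literature.Probability.LatticeModels

namespace Summit.QuantumFields.YangMills.Cruxes.GapToContinuum.RestatementA1

open Summit.QuantumFields.YangMills.Theses.LangevinControlUV

variable {G : Type} [Group G] [TopologicalSpace G] [IsTopologicalGroup G] [CompactSpace G]
  [MeasurableSpace G] [BorelSpace G]

/-- **Diagonal lattice clustering at rate `Δ` along the scheme (def-free form of
`SpeciesScheme.HasDiagClustering`)**: for every arity `n ≥ 1`, species string `σ` and ONE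
slab-ordered real factor datum `p` there is a constant `C` such that for all `t ≥ 0`, `ε > 0`,
eventually in `k`, `‖Λᵏ₂ₙ(θpʳ ++ T_t p) − Λᵏₙ(θpʳ) Λᵏₙ(p)‖ ≤ C e^{−Δt} + ε`, `Λᵏ` the lattice
`n`-point functions `latticeSchwinger r.ρ sch` on the scheme's own tori. -/
def HasDiagClusteringInline (r : LatticeRep G) (sch : SpeciesScheme (YMSpecies G)) (Δ : ℝ) : Prop :=
  ∀ (n : ℕ), n ≠ 0 → ∀ (σ : Fin n → YMSpecies G) (p : Fin n → 𝓢(EuclideanSpace ℝ (Fin 4), ℝ)),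
    IsSlabOrdered p → ∃ C : ℝ, ∀ t : ℝ, 0 ≤ t → ∀ ε : ℝ, 0 < ε → ∀ᶠ k in atTop,
      ‖((latticeSchwinger r.ρ sch (fun s => s.F) k (n + n) (Fin.append (σ ∘ Fin.rev) σ)
            (Fin.append (fun l => thetaTest 4 (p (Fin.rev l)))
              (fun l => translateTest (EuclideanSpace.single 0 t) (p l))) : ℝ) : ℂ) -
          ((latticeSchwinger r.ρ sch (fun s => s.F) k n (σ ∘ Fin.rev)
              (fun l => thetaTest 4 (p (Fin.rev l))) : ℝ) : ℂ) *
            ((latticeSchwinger r.ρ sch (fun s => s.F) k n σ p : ℝ) : ℂ)‖ ≤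
        C * Real.exp (-Δ * t) + ε

/-- **R5 — the restated crux (diagonal interface).** -/
def GapToContinuumDiag : Prop :=
  ∀ (G : Type) [Group G] [TopologicalSpace G] [IsTopologicalGroup G] [CompactSpace G]
    [MeasurableSpace G] [BorelSpace G] (r : LatticeRep G) (sch : SpeciesScheme (YMSpecies G))
    (T : OSData (YMSpecies G) 4) (Δ : ℝ), 0 < Δ → IsYangMillsFor r sch T →
      HasDiagClusteringInline r sch Δ → T.HasMassGap Δ

/-- **R5 is a theorem** (L1: `IsYangMillsFor.hasMassGap_of_diagClustering`). -/
theorem gapToContinuumDiag_holds : GapToContinuumDiag :=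
  fun _G _ _ _ _ _ _ _r _sch _T _Δ _ hYM hD => hYM.hasMassGap_of_diagClustering hD

/-- **stmt-QuantumFields-16207 restated (R5 companion)**: `OSLegsAtWeakCouplingC` verbatim, last
conjunct strengthened to `∃ Δ > 0, HasLatticeMassGap r sch Δ ∧ HasDiagClusteringInline r sch Δ`. -/
def OSLegsAtWeakCouplingDiag : Prop :=
  open Literature.MathematicalPhysics.QuantumFieldTheory in ∀ (G : Type) [Group G] [TopologicalSpace G] [IsTopologicalGroup G] [CompactSpace G], IsCompactSimpleLieGroup G → letI : MeasurableSpace G := borel G; haveI : BorelSpace G := ⟨rfl⟩; ∀ (r : LatticeRep G), ∀ (a : ℝ → ℝ), Continuous a → (∃ (Γ : ℝ → ℝ) (β₀ ℓ₀ c C : ℝ), 0 < ℓ₀ ∧ 0 < c ∧ (∀ β, 0 < a β) ∧ Filter.Tendsto a Filter.atTop (nhds 0) ∧ (∀ s : ℝ, 0 < s → s ≤ ℓ₀ → 0 < Γ s ∧ Γ s ≤ 1) ∧ ∀ (L : ℕ) [NeZero L] (β : ℝ), β₀ ≤ β → (L : ℝ) * a β ≤ ℓ₀ → let P : (Fin 4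 → ZMod L) → Fin 4 → Fin 4 → GaugeConfig 4 L G → ℝ := fun x i j U => (r.N : ℝ) - (r.ρ (plaquetteHolonomy U x i j)).trace.re; let E : (GaugeConfig 4 L G → ℝ) → ℝ := fun F => wilsonExpectation (d := 4) (L := L) r.ρ β F; let cov : (GaugeConfig 4 L G → ℝ) → (GaugeConfig 4 L G → ℝ) → ℝ := fun F F' => E (fun U => F U * F' U) - E F * E F'; let dist : (Fin 4 → ZMod L) → (Fin 4 → ZMod L) → ℝ := fun x y => Real.sqrt (∑ k : Fin 4, (((x k - y k).valMinAbs : ℤ) : ℝ) ^ 2); (∀ n : ℕ, 1 ≤ n → 8 * n ≤ L → c * Γ ((n : ℝ) * a β) ≤ (n : ℝ) ^ 8 * cov (P 0 0 1) (P (Pi.single (2 : Fin 4) ((n : ℕ) : ZMod L)) 0 1) ∧ (n : ℝ) ^ 8 * cov (P 0 0 1) (P (Pi.single (2 : Fin 4) ((n : ℕ) : ZMod L)) 0 1) ≤ C * Γ ((n : ℝ) * a β)) ∧ (∀ (x y : Fin 4 → ZMod L) (i j i' j' : Fin 4), x ≠ y → i ≠ j → i' ≠ j' → |cov (P x i j)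 (P y i' j')| * dist x y ^ 8 ≤ C * Γ (dist x y * a β))) → (∃ (Γ₃ : ℝ → ℝ) (β₁ ℓ₁ c₃ : ℝ), 0 < ℓ₁ ∧ 0 < c₃ ∧ (∀ s : ℝ, 0 < s → s ≤ ℓ₁ → 0 < Γ₃ s) ∧ ∀ (L : ℕ) [NeZero L] (β : ℝ), β₁ ≤ β → (L : ℝ) * a β ≤ ℓ₁ → let P : (Fin 4 → ZMod L) → Fin 4 → Fin 4 → GaugeConfig 4 L G → ℝ := fun x i j U => (r.N : ℝ) - (r.ρ (plaquetteHolonomy U x i j)).trace.re; let E : (GaugeConfig 4 L G → ℝ) → ℝ := fun F => wilsonExpectation (d := 4) (L := L) r.ρ β F; let cov : (GaugeConfig 4 L G → ℝ) → (GaugeConfig 4 L G → ℝ) → ℝ := fun F F' => E (fun U => F U * F' U) - E F * E F'; ∀ n : ℕ, 1 ≤ n → 8 * n ≤ L → c₃ * Γ₃ ((n : ℝ) * a β) ≤ (n : ℝ) ^ 12 * |E (fun U => P 0 0 1 U * P (Pi.single (2 : Fin 4) ((n : ℕ) : ZMod L)) 0 1 U * P (Pi.single (3 : Fin 4) ((n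 : ℕ) : ZMod L)) 0 1 U) - E (P 0 0 1) * cov (P (Pi.single (2 : Fin 4) ((n : ℕ) : ZMod L)) 0 1) (P (Pi.single (3 : Fin 4) ((n : ℕ) : ZMod L)) 0 1) - E (P (Pi.single (2 : Fin 4) ((n : ℕ) : ZMod L)) 0 1) * cov (P 0 0 1) (P (Pi.single (3 : Fin 4) ((n : ℕ) : ZMod L)) 0 1) - E (P (Pi.single (3 : Fin 4) ((n : ℕ) : ZMod L)) 0 1) * cov (P 0 0 1) (P (Pi.single (2 : Fin 4) ((n : ℕ) : ZMod L)) 0 1) - E (P 0 0 1) * E (P (Pi.single (2 : Fin 4) ((n : ℕ) : ZMod L)) 0 1) * E (P (Pi.single (3 : Fin 4) ((n : ℕ) : ZMod L)) 0 1)|) → (∃ (c₁ β₂ : ℝ) (S₁ : ℝ → ℕ), 0 < c₁ ∧ ∀ A B : YMSpecies G, ∃ C : ℝ, ∀ β : ℝ, β₂ ≤ β → ∀ S n : ℕ, S₁ β ≤ S → n ≤ S → |latticeConnectedCorr r.ρ β (2 * S + 1) A.F B.F n| ≤ C * Real.exp (-(c₁ * a β * n))) → ∃ (sch : SpeciesScheme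 (YMSpecies G)) (T : OSData (YMSpecies G) 4), (∀ k, sch.a k = a (sch.β k)) ∧ sch.HasWeakCouplingLimit ∧ IsYangMillsFor r sch T ∧ T.IsNontrivial r.curvature ∧ T.IsNonGaussian r.curvature ∧ ∃ Δ > 0, HasLatticeMassGap r sch Δ ∧ HasDiagClusteringInline r sch Δ

/-- It implies the current item stmt-QuantumFields-16207 outright. -/
theorem osLegsAtWeakCouplingC_of_diag (h : OSLegsAtWeakCouplingDiag) : OSLegsAtWeakCouplingC := by
  intro G _ _ _ _ hG r a ha hPa hSk hCl
  obtain ⟨sch, T, hsch, hW, hYM, hNT, hNG, Δ, hΔ, hlat, -⟩ := h G hG r a ha hPa hSk hCl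
  exact ⟨sch, T, hsch, hW, hYM, hNT, hNG, Δ, hΔ, hlat⟩

/-- **The deciding theorem with FOUR hypotheses**: the gap-transfer crux is discharged by
`gapToContinuumDiag_holds`. -/
theorem closes_restatedDiag (hUV : FemtoCurvatureTwoPointC) (hSkew : FemtoCurvatureSkewnessC)
    (hIR : LatticeGapInUVUnitsC) (hOS : OSLegsAtWeakCouplingDiag) : YangMills := by
  intro G _ _ _ _ hG
  letI : MeasurableSpace G := borel G
  haveI : BorelSpace G := ⟨rfl⟩
  obtain ⟨r⟩ := hG.2
  obtain ⟨a, ha, hPa, hSk⟩ := hSkew G hG r (hUV G hG r)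
  have hCl := hIR G hG r a ha hPa
  obtain ⟨sch, T, _, hW, hYM, hNT, hNG, Δ, hΔ, hlat, hD⟩ := hOS G hG r a ha hPa hSk hCl
  exact ⟨r, sch, T, hW, hYM, hNT, hNG, Δ, hΔ, gapToContinuumDiag_holds G r sch T Δ hΔ hYM hD, hlat⟩

end Summit.QuantumFields.YangMills.Cruxes.GapToContinuum.RestatementA1

end
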